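import Mathlib
import HarnessLib

/-!
# Route PrincipalMinorColouring — crux `BorderBoundedRankTwo` (stmt-ValiantsHypothesis-21038): vocabulary of
# the line `closure_counting` (route-posited objects, D-0016 `<RouteSlug>Defs.lean`)

The registered skeleton `Cruxes/BorderBoundedRankTwo/Lines/closure_counting.lean` (val-width-lines-2; T6 rung
`r = 2` of `BorderBoundedRank`, stmt-3778) phrases its two stubs (`stub_transport`, `stub_denseCount`) in a
small local vocabulary: the normal-form coefficient map of Hrubeš–Joglekar 2025, Lemma 1, and the union of
its images over all slot patterns with at most `2k` slots.  The stub files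
`Theorems/PrincipalMinorColouringBorderBoundedRankTwo*.lean` that land these stubs by name must speak about
THE SAME declarations, so the vocabulary is collected here, VERBATIM from the skeleton (same names, same
bodies; namespace `Summit.ValiantsHypothesis.ValiantsHypothesis.Theorems.BorderBoundedRankTwoClosureCounting`).
Nothing here asserts anything; no instance, no notation.

* `monB r` — the exponent vector of the multilinear monomial `∏_{i : r i} X_i` on `k` abstract variables;
* `nfMap k s ι (a, H)` — the `2^k` coefficients `r ↦ coeff_{monB r} (a · det (diag(X_{ι 1}, …, X_{ι s}, 0, …, 0) + H))`
  of the scaled `2s × 2s` normal-form determinant (Hrubeš–Joglekar 2025, Lemma 1) with its `s` variable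
  slots filled according to `ι : Fin s → Fin k`;
* `NFImage k` — the union of the images `range (nfMap k s ι)` over all `s ≤ 2k` and all `ι`.

References: P. Hrubeš, P. S. Joglekar, *On read-k projections of the determinant*, STACS 2025, LIPIcs 327,
Art. 53, Lemma 1 (p. 53:3), Thm. 2 (p. 53:4). [HrubesJoglekar2025]
-/

noncomputable section

-- `Summit.ValiantsHypothesis.ValiantsHypothesis.…` is the tree's single-conjunct layout (Sub = Summit).
set_option linter.dupNamespace false

namespace Summit.ValiantsHypothesis.ValiantsHypothesis.Theorems.BorderBoundedRankTwoClosureCounting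

open MvPolynomial Matrix

/-- The multilinear monomial `∏_{i : r i} X_i` on `k` abstract variables, as an exponent vector (verbatim the
skeleton's `monB`). [folklore] -/
def monB {k : ℕ} (r : Fin k → Bool) : Fin k →₀ ℕ :=
  ∑ i ∈ Finset.univ.filter (fun i => r i = true), Finsupp.single i 1

/-- The normal-form coefficient map of Hrubeš–Joglekar's Lemma 1 with `s` variable slots filled according to `ι`:
`(a, H) ↦ (r ↦ coeff_{monB r} (a · det (diag(X_{ι 1}, …, X_{ι s}, 0, …, 0) + H)))` (verbatim the skeleton's
`nfMap`). [cite: HrubesJoglekar2025, Lemma 1 (p. 53:3)] -/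
def nfMap (k s : ℕ) (ι : Fin s → Fin k) (p : ℂ × Matrix (Fin s ⊕ Fin s) (Fin s ⊕ Fin s) ℂ) : (Fin k → Bool) → ℂ :=
  fun r => coeff (monB r) (C p.1 * (diagonal (Sum.elim (fun q => (X (ι q) : MvPolynomial (Fin k) ℂ)) 0) +
    p.2.map (fun a : ℂ => (C a : MvPolynomial (Fin k) ℂ))).det)

/-- The union of the normal-form images over all slot patterns with at most `2k` slots (classes of size `≤ 2`)
(verbatim the skeleton's `NFImage`). [cite: HrubesJoglekar2025, Thm. 2 (p. 53:4)] -/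
def NFImage (k : ℕ) : Set ((Fin k → Bool) → ℂ) :=
  ⋃ (s : Fin (2 * k + 1)), ⋃ (ι : Fin (s : ℕ) → Fin k), Set.range (nfMap k s ι)

end Summit.ValiantsHypothesis.ValiantsHypothesis.Theorems.BorderBoundedRankTwoClosureCounting
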